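import Summits.Ventures.PercRepro.C025ProfileTopHallNullity

/-!
# THE DISJOINTNESS LEMMA AT EVERY NULLITY IN RANK LANGUAGE (night-3 g22)

«Spanning up to `k` points» is a rank condition: for `Y ⊆ E` with complement `Z = E ∖ Y`, some `X ⊆ Z` with
`|X| ≤ k` makes `Y ∪ X` spanning iff `ρ(E) ≤ ρ(Y) + k` (`spanning_upto_iff_eRank_le`: a base through a basis of
`Y` adds at most `k` points outside `Y`; conversely `ρ(Y ∪ X) ≤ ρ(Y) + |X|`).  So the lemma of the companion
module reads, for every finite matroid `M`, every `k` and every family `𝒜` of subsets `B` of `E` with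
`ρ(E ∖ B) + k ≥ ρ(E)`:
  `#𝒜 ≤ #{S ⊆ E : ρ(S) + k ≥ ρ(E) ∧ ∃ B ∈ 𝒜, B ⊆ S}`
(**`card_le_card_eRk_add`**); `k = 0` is the top row (coindependent members, spanning supersets).  And in any
up-set of the Boolean lattice the sets whose complement has corank `≤ k` are at most the sets of corank `≤ k`
(**`card_le_card_eRk_add_upset`**, the maximal family `{X ⊇ some B ∈ 𝒜 : ρ(E ∖ X) + k ≥ ρ(E)}`).
No `def`, no `instance`, no notation.  Axioms: standard.
-/

open scoped Matroid

namespace PercRepro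

open Set Finset ThmH

namespace TopHall

variable {α : Type} [DecidableEq α] {M : Matroid α} [M.Finite]

/-- **Spanning up to `k` points is a rank condition**: for `Y ⊆ E`, some `X ⊆ E ∖ Y` with `|X| ≤ k` makes `Y ∪ X`
spanning iff `ρ(E) ≤ ρ(Y) + k`. -/
theorem spanning_upto_iff_eRank_le {k : ℕ} {Y : Finset α} (hY : Y ⊆ gr M) :
    (∃ X ⊆ gr M \ Y, X.card ≤ k ∧ M.Spanning ((Y ∪ X : Finset α) : Set α)) ↔
      M.eRank ≤ M.eRk (Y : Set α) + k := by
  constructor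
  · rintro ⟨X, _, hXk, hXs⟩
    calc M.eRank = M.eRk ((Y ∪ X : Finset α) : Set α) := hXs.eRk_eq.symm
      _ ≤ M.eRk (Y : Set α) + M.eRk (X : Set α) := by
          rw [Finset.coe_union]
          exact M.eRk_union_le_eRk_add_eRk _ _
      _ ≤ M.eRk (Y : Set α) + (X : Set α).encard := add_le_add le_rfl (M.eRk_le_encard _)
      _ ≤ M.eRk (Y : Set α) + k := by
          rw [Set.encard_coe_eq_coe_finsetCard]
          exact add_le_add le_rfl (by exact_mod_cast hXk)
  · intro hk
    have hYE : (Y : Set α) ⊆ M.E := by rw [← coe_gr]; exact Finset.coe_subset.2 hY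
    -- a basis `I` of `Y`, extended to a base `J`; the points of `J` outside `Y` are at most `k`
    obtain ⟨I, hI⟩ := M.exists_isBasis (Y : Set α) hYE
    obtain ⟨J, hJ, hIJ⟩ := hI.indep.exists_isBase_superset
    have hJfin : J.Finite := Matroid.Finite.ground_finite.subset hJ.subset_ground
    have hXfin : (J \ (Y : Set α)).Finite := hJfin.subset Set.sdiff_subset
    obtain ⟨X, hX⟩ := hXfin.exists_finset_coe
    have hIfin : I.encard ≠ ⊤ := ((Finset.finite_toSet Y).subset hI.subset).encard_lt_top.ne
    have hcard : (J \ (Y : Set α)).encard ≤ k := by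
      have h1 : (J \ (Y : Set α)).encard ≤ (J \ I).encard :=
        Set.encard_le_encard (Set.sdiff_subset_sdiff_right hI.subset)
      have h2 : (J \ I).encard + I.encard = J.encard := Set.encard_sdiff_add_encard_of_subset hIJ
      rw [hJ.encard_eq_eRank, ← hI.encard_eq_eRk] at *
      have h3 : (J \ I).encard + I.encard ≤ k + I.encard := by
        rw [h2, add_comm]
        exact hk
      exact h1.trans ((ENat.add_le_add_iff_right hIfin).1 h3)
    refine ⟨X, ?_, ?_, ?_⟩
    · rw [← Finset.coe_subset, hX, Finset.coe_sdiff, coe_gr]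
      exact Set.sdiff_subset_sdiff_left hJ.subset_ground
    · have := hcard
      rw [← hX, Set.encard_coe_eq_coe_finsetCard] at this
      exact_mod_cast this
    · refine hJ.spanning.superset ?_ ?_
      · rw [Finset.coe_union, hX]
        intro x hxJ
        by_cases hxY : x ∈ (Y : Set α)
        · exact Or.inl hxY
        · exact Or.inr ⟨hxJ, hxY⟩
      · rw [Finset.coe_union, hX]
        exact Set.union_subset hYE (Set.sdiff_subset.trans hJ.subset_ground)

open scoped Classical in
/-- **THE DISJOINTNESS LEMMA AT EVERY NULLITY, IN RANK LANGUAGE**: for every family `𝒜` of subsets `B` of `E` with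
`ρ(E ∖ B) + k ≥ ρ(E)`, the sets `S ⊇ some B ∈ 𝒜` with `ρ(S) + k ≥ ρ(E)` number at least the members
(`k = 0`: coindependent members, spanning supersets — the top row). -/
theorem card_le_card_eRk_add (k : ℕ) (𝒜 : Finset (Finset α))
    (h𝒜 : ∀ B ∈ 𝒜, B ⊆ gr M ∧ M.eRank ≤ M.eRk ((gr M \ B : Finset α) : Set α) + k) :
    𝒜.card ≤ ((gr M).powerset.filter (fun S : Finset α =>
      M.eRank ≤ M.eRk (S : Set α) + k ∧ ∃ B ∈ 𝒜, B ⊆ S)).card := by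
  have h1 := card_le_card_spanning_upto k 𝒜 (by
    intro B hB
    obtain ⟨hBg, hBk⟩ := h𝒜 B hB
    refine ⟨hBg, ?_⟩
    have := (spanning_upto_iff_eRank_le (Finset.sdiff_subset : gr M \ B ⊆ gr M)).2 hBk
    rw [Finset.sdiff_sdiff_eq_self hBg] at this
    exact this)
  refine h1.trans (Finset.card_le_card ?_)
  intro S hS
  rw [Finset.mem_filter, Finset.mem_powerset] at hS ⊢
  exact ⟨hS.1, (spanning_upto_iff_eRank_le hS.1).1 hS.2.1, hS.2.2⟩

open scoped Classical in
/-- **In any up-set, the sets whose complement has corank `≤ k` are at most the sets of corank `≤ k`**: for every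
family `𝒜` of subsets of `E`, `#{X ⊇ some B ∈ 𝒜 : ρ(E ∖ X) + k ≥ ρ(E)} ≤ #{S ⊇ some B ∈ 𝒜 : ρ(S) + k ≥ ρ(E)}` —
the lemma applied to the maximal family. -/
theorem card_le_card_eRk_add_upset (k : ℕ) (𝒜 : Finset (Finset α)) :
    ((gr M).powerset.filter (fun X : Finset α =>
      M.eRank ≤ M.eRk ((gr M \ X : Finset α) : Set α) + k ∧ ∃ B ∈ 𝒜, B ⊆ X)).card ≤
    ((gr M).powerset.filter (fun S : Finset α =>
      M.eRank ≤ M.eRk (S : Set α) + k ∧ ∃ B ∈ 𝒜, B ⊆ S)).card := by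
  have h1 := card_le_card_eRk_add k ((gr M).powerset.filter (fun X : Finset α =>
      M.eRank ≤ M.eRk ((gr M \ X : Finset α) : Set α) + k ∧ ∃ B ∈ 𝒜, B ⊆ X)) (by
    intro X hX
    rw [Finset.mem_filter, Finset.mem_powerset] at hX
    exact ⟨hX.1, hX.2.1⟩)
  refine h1.trans (Finset.card_le_card ?_)
  intro S hS
  rw [Finset.mem_filter, Finset.mem_powerset] at hS ⊢
  obtain ⟨hSg, hSk, X, hX, hXS⟩ := hS
  rw [Finset.mem_filter] at hX
  obtain ⟨B, hB, hBX⟩ := hX.2.2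
  exact ⟨hSg, hSk, B, hB, hBX.trans hXS⟩

end TopHall

end PercRepro
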